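/-
Copyright (c) 2026. All rights reserved.
Released under Apache 2.0 license as described in the file LICENSE.
Authors: abc-iut cell, F-lane seat abc-iut-f-187 (gen 3), KEY INST59L2.
-/
import Literature.AnabelianGeometry.AbsoluteAnabelian.RelativeGCHomSchemaWitnesses
import Literature.AnabelianGeometry.AbsoluteAnabelian.RelativeGCHomPointDatumInstances
import HarnessLib

/-!
# [pGC] Theorem A, isomorphism form (FACT-LIST F-1795 `pGC.ThmA_isom`): CLOSED INSTANCE FORMS of the
# model-relative typing (proof-only)

S. Mochizuki, *The local pro-`p` anabelian geometry of curves*, Invent. Math. **138** (1999) [pGC],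
Theorem A p. 3, remark (3): "the isomorphisms of `X_K` with `Y_K` are in natural bijective correspondence
with the outer isomorphisms over `Γ_K` of `Π_{X_K}` with `Π_{Y_K}`" (hyperbolic curves over a sub-`p`-adic
`K`; a special case of the profinite version of Theorem A). [cite: MochizukiLocAn1999, Thm A p.3]

PROOF-ONLY companion (no `def`, no `structure`, no `instance`, no notation) of abc-iut-L4-t13's
`RelativeGrothendieckConjecture.lean`, where the isomorphism form is typed MODEL-RELATIVELY (cell ruling θ,
shape (M)) as `pGC.ThmA_isom K D := IsSubpadic K → D.primes = Set.univ → D.RelIsomGC` on an abstract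
interface datum `D : RelativeAnabelianDatum (absoluteGaloisGrp K)`.

Bookkeeping context (abc-iut cell, block F, KEY row INST59L2).  The universal closure of the schema is
REFUTED in the tree (`pGC.not_forall_thmA_isom`: over `ℚ_2`, the junk datum with `Hom = ∅` over the point,
`RelativeGCHomSchemaWitnesses.lean`); its instance forms so far live only inside the `∃`-statement
`pGC.exists_datum_thmA_and_thmA_isom` and behind hypotheses (`pGC.thmA_isom_of_thmA`,
`pGC.thmA_isom_of_thm_4_12`), so the L-F kernel census found NO theorem whose conclusion head is
`pGC.ThmA_isom`.  This file supplies CLOSED conclusion-head forms at a datum written out as a literal term —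
the ONE-OBJECT DATUM OVER THE POINT of `RelativeGCHomPointDatumInstances.lean` (`Π_X := Γ_K ↠ Γ_K` the
identity, `Hom = {id}` declared an isomorphism and a hyperbolic curve, `Σ := Set.univ`, `f ↦ [id]`), whose
`RelIsomGC` is the tree's theorem `RelativeAnabelianDatum.relIsomGC_pointDatum`:

* `pGC.thmA_isom_pointDatum K` — over EVERY base field `K` of characteristic zero (the field binder is a
  type parameter, not a hypothesis): the typed isomorphism form holds at the point datum over `Γ_K`;
* `pGC.thmA_isom_pointDatum_padicTwo` — the 0-binder instance over the sub-`2`-adic field `ℚ_2`, i.e. at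
  the very base field of the closure refuter `pGC.not_forall_thmA_isom` (which uses the `Hom = ∅` junk datum
  there): the schema is decided datum by datum;
* `pGC.thmA_isom_pointDatum_rat` — the 0-binder instance over `ℚ`;
* `pGC.thmA_and_thmA_isom_pointDatum K` — hom form (F-1794) and isom form (F-1795) jointly, at the same
  literal datum (conclusion an `∧` of the two FACT-LIST heads).

HONEST LABEL: «INSTANCE at toy carrier» — the point datum is DEGENERATE (`Δ = 1`; no hyperbolic curve has
trivial geometric fundamental group); these are statements about OUR typed interface, exactly the instance
the closure refuter's junk spares.  The INTENDED instance — the étale `π₁` of hyperbolic curves over a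
sub-`p`-adic field — is not constructible in the tree (FOUNDATIONS row 12 of the cell); there the row is
Mochizuki's theorem and stays a NAMED FACT consumed by name.  Refuted-as-schema ≠ refuted-in-print;
instantiated ≠ endorsed; typed ≠ proved; nothing here bears on [IUTchIII] Cor. 3.12, and nothing asserts
abc proved or refuted.
-/

universe u

namespace Literature.AnabelianGeometry.AbsoluteAnabelian

open AbsTopIII

/-- **F-1795, CLOSED INSTANCE FORM over every base field** (toy carrier, labelled): for every field `K` of
characteristic zero, the typed isomorphism form `pGC.ThmA_isom K D` HOLDS at the one-object datum over the
point `Π = Γ_K ↠ Γ_K` (`Hom = {id}`, `Σ = Set.univ`, `f ↦ [id]`) — because that datum's `RelIsomGC` holds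
tautologically (`RelativeAnabelianDatum.relIsomGC_pointDatum`).  DEGENERATE (`Δ = 1`).
[cite: MochizukiLocAn1999, Thm A p.3] -/
theorem pGC.thmA_isom_pointDatum (K : Type u) [Field K] [CharZero K] :
    Literature.AnabelianGeometry.AbsoluteAnabelian.pGC.ThmA_isom K
      ({ Obj := PUnit.{u + 1}
         Hom := fun _ _ => PUnit.{u + 1}
         IsIso := fun _ => True
         IsHyperbolicCurve := fun _ => True
         primes := Set.univ
         grp := fun _ =>
           { arith := absoluteGaloisGrp K, aug := ContinuousMonoidHom.id (absoluteGaloisGrp K),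
             aug_surjective := Function.surjective_id }
         outerHom := fun _ =>
           AugmentedProfiniteGrp.OuterHom.mk ⟨ContinuousMonoidHom.id _, fun _ => rfl⟩ } :
        RelativeAnabelianDatum (absoluteGaloisGrp K)) :=
  fun _ _ => RelativeAnabelianDatum.relIsomGC_pointDatum (absoluteGaloisGrp K)

/-- **F-1795, CLOSED INSTANCE FORM over `ℚ_2`, 0 binders** (toy carrier, labelled): at the sub-`2`-adic base
field of the tree's closure refuter `pGC.not_forall_thmA_isom` — whose witness is the `Hom = ∅` junk datum —
the point datum (`Hom = {id}`) SATISFIES the typed isomorphism form; so over `ℚ_2` the schema holds at one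
datum and fails at another. [cite: MochizukiLocAn1999, Thm A p.3] -/
theorem pGC.thmA_isom_pointDatum_padicTwo :
    Literature.AnabelianGeometry.AbsoluteAnabelian.pGC.ThmA_isom ℚ_[2]
      ({ Obj := PUnit.{1}
         Hom := fun _ _ => PUnit.{1}
         IsIso := fun _ => True
         IsHyperbolicCurve := fun _ => True
         primes := Set.univ
         grp := fun _ =>
           { arith := absoluteGaloisGrp ℚ_[2], aug := ContinuousMonoidHom.id (absoluteGaloisGrp ℚ_[2]),
             aug_surjective := Function.surjective_id }
         outerHom := fun _ =>
           AugmentedProfiniteGrp.OuterHom.mk ⟨ContinuousMonoidHom.id _, fun _ => rfl⟩ } :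
        RelativeAnabelianDatum (absoluteGaloisGrp ℚ_[2])) :=
  pGC.thmA_isom_pointDatum ℚ_[2]

/-- **F-1795, CLOSED INSTANCE FORM over `ℚ`, 0 binders** (toy carrier, labelled): the point datum over
`Γ_ℚ` satisfies the typed isomorphism form of [pGC] Thm A. [cite: MochizukiLocAn1999, Thm A p.3] -/
theorem pGC.thmA_isom_pointDatum_rat :
    Literature.AnabelianGeometry.AbsoluteAnabelian.pGC.ThmA_isom ℚ
      ({ Obj := PUnit.{1}
         Hom := fun _ _ => PUnit.{1}
         IsIso := fun _ => True
         IsHyperbolicCurve := fun _ => True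
         primes := Set.univ
         grp := fun _ =>
           { arith := absoluteGaloisGrp ℚ, aug := ContinuousMonoidHom.id (absoluteGaloisGrp ℚ),
             aug_surjective := Function.surjective_id }
         outerHom := fun _ =>
           AugmentedProfiniteGrp.OuterHom.mk ⟨ContinuousMonoidHom.id _, fun _ => rfl⟩ } :
        RelativeAnabelianDatum (absoluteGaloisGrp ℚ)) :=
  pGC.thmA_isom_pointDatum ℚ

/-- **F-1794 ∧ F-1795 jointly at the same literal datum** (toy carrier, labelled): over every field `K` of
characteristic zero the point datum over `Γ_K` satisfies BOTH the hom form `pGC.ThmA` and the isom form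
`pGC.ThmA_isom` of [pGC] Thm A as typed (`relHomGC_pointDatum` / `relIsomGC_pointDatum`).  DEGENERATE
(`Δ = 1`). [cite: MochizukiLocAn1999, Thm A p.3] -/
theorem pGC.thmA_and_thmA_isom_pointDatum (K : Type u) [Field K] [CharZero K] :
    Literature.AnabelianGeometry.AbsoluteAnabelian.pGC.ThmA K
      ({ Obj := PUnit.{u + 1}
         Hom := fun _ _ => PUnit.{u + 1}
         IsIso := fun _ => True
         IsHyperbolicCurve := fun _ => True
         primes := Set.univ
         grp := fun _ =>
           { arith := absoluteGaloisGrp K, aug := ContinuousMonoidHom.id (absoluteGaloisGrp K),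
             aug_surjective := Function.surjective_id }
         outerHom := fun _ =>
           AugmentedProfiniteGrp.OuterHom.mk ⟨ContinuousMonoidHom.id _, fun _ => rfl⟩ } :
        RelativeAnabelianDatum (absoluteGaloisGrp K)) ∧
    Literature.AnabelianGeometry.AbsoluteAnabelian.pGC.ThmA_isom K
      ({ Obj := PUnit.{u + 1}
         Hom := fun _ _ => PUnit.{u + 1}
         IsIso := fun _ => True
         IsHyperbolicCurve := fun _ => True
         primes := Set.univ
         grp := fun _ =>
           { arith := absoluteGaloisGrp K, aug := ContinuousMonoidHom.id (absoluteGaloisGrp K),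
             aug_surjective := Function.surjective_id }
         outerHom := fun _ =>
           AugmentedProfiniteGrp.OuterHom.mk ⟨ContinuousMonoidHom.id _, fun _ => rfl⟩ } :
        RelativeAnabelianDatum (absoluteGaloisGrp K)) :=
  ⟨fun _ _ => RelativeAnabelianDatum.relHomGC_pointDatum (absoluteGaloisGrp K),
    pGC.thmA_isom_pointDatum K⟩

end Literature.AnabelianGeometry.AbsoluteAnabelian
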